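import Mathlib

/-!
# Isotypic subspaces of distinct characters are independent — for any group and any complex
representation (kernel witness: the independence half of the standard fact (A1) without finiteness)

Blind cell `pub-hodge-repro2`, seat p4, Tier-5 support. README §8(d): this file uses an
L-value-free non-vanishing device: NO (a kernel check of a standard fact already on the cell's
record).

`T5CharacterProjectors.lean` (p391097) proves the isotypic decomposition `V = ⨁_α V[α]` for a
FINITE abelian group by the character projectors. The standard fact (A1) of
`route/T5-route-2.md` §N5.11.7 is used for the compact group `E¹_v` (a smooth representation is
the direct sum of its isotypic components). Here the INDEPENDENCE half is kernel-checked with no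
finiteness at all: for an arbitrary group `G`, an arbitrary representation `ρ` of `G` on a complex
vector space `V` of any dimension, and characters `χ : G →* ℂ`, the joint eigenspaces
`V[χ] = {v | ∀ g, ρ g v = χ g • v}` form an independent family of subspaces (`iSupIndep`): a finite
sum `∑ v_χ = 0` with `v_χ ∈ V[χ]` forces every `v_χ = 0`.

The proof is Dedekind's: a linear functional `ℓ` applied to `ρ g (∑ v_χ) = ∑ χ(g) v_χ` shows that
`∑ ℓ(v_χ) · χ = 0` as a function on `G`, so every `ℓ(v_χ) = 0` by the linear independence of
distinct characters (Mathlib's `linearIndependent_monoidHom`), and a vector killed by every linear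
functional is `0` (`Module.forall_dual_apply_eq_zero_iff`).

* `isotypic ρ χ` — the joint eigenspace of the character `χ`;
* `isotypic_inf_eq_bot` — two distinct characters have trivial common eigenspace;
* **`iSupIndep_isotypic`** — the family `χ ↦ V[χ]` is independent;
* `eq_zero_of_sum_eq_zero` — the finite-sum form: `∑_{χ ∈ s} v χ = 0`, `v χ ∈ V[χ]` ⇒ `v χ = 0`.

The SPANNING half (`⨆_χ V[χ] = ⊤`) is where finiteness / smoothness enters; it is proved for finite
abelian groups in `T5CharacterProjectors` and is not claimed here in general.

Mathlib only; no sorry; axioms ⊆ {propext, Classical.choice, Quot.sound}.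
-/

namespace Summit.Ventures.HodgeRepro2.T5IsotypicIndependence

variable {G : Type*} [Group G] {V : Type*} [AddCommGroup V] [Module ℂ V]

/-- The joint eigenspace (isotypic subspace) of the character `χ : G →* ℂ`. -/
def isotypic (ρ : Representation ℂ G V) (χ : G →* ℂ) : Submodule ℂ V where
  carrier := {v | ∀ g : G, ρ g v = χ g • v}
  zero_mem' := by intro g; simp
  add_mem' := by
    intro v w hv hw g
    simp only [Set.mem_setOf_eq] at hv hw
    rw [map_add, hv g, hw g, smul_add]
  smul_mem' := by
    intro c v hv g
    simp only [Set.mem_setOf_eq] at hv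
    rw [map_smul, hv g, smul_comm]

/-- Membership in the isotypic subspace. -/
theorem mem_isotypic {ρ : Representation ℂ G V} {χ : G →* ℂ} {v : V} :
    v ∈ isotypic ρ χ ↔ ∀ g : G, ρ g v = χ g • v := Iff.rfl

/-- A functional applied to a finite sum of isotypic vectors moved by `ρ g`: the coefficients are
the character values. -/
theorem dual_apply_rho_sum (ρ : Representation ℂ G V) (ℓ : Module.Dual ℂ V) (s : Finset (G →* ℂ))
    (v : (G →* ℂ) → V) (hv : ∀ χ ∈ s, v χ ∈ isotypic ρ χ) (g : G) :
    ℓ (ρ g (∑ χ ∈ s, v χ)) = ∑ χ ∈ s, ℓ (v χ) * χ g := by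
  rw [map_sum, map_sum]
  refine Finset.sum_congr rfl fun χ hχ => ?_
  rw [hv χ hχ g, map_smul, smul_eq_mul, mul_comm]

/-- The finite-sum form of independence: if `∑_{χ ∈ s} v χ = 0` with `v χ ∈ V[χ]`, then every
`v χ` (`χ ∈ s`) vanishes (Dedekind's lemma + duality). -/
theorem eq_zero_of_sum_eq_zero (ρ : Representation ℂ G V) (s : Finset (G →* ℂ))
    (v : (G →* ℂ) → V) (hv : ∀ χ ∈ s, v χ ∈ isotypic ρ χ) (hsum : ∑ χ ∈ s, v χ = 0) :
    ∀ χ ∈ s, v χ = 0 := by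
  intro χ hχ
  rw [← Module.forall_dual_apply_eq_zero_iff ℂ]
  intro ℓ
  -- the function `g ↦ ∑ ℓ(v χ) χ(g)` vanishes
  have hfun : ∑ χ' ∈ s, ℓ (v χ') • (⇑χ' : G → ℂ) = 0 := by
    funext g
    simp only [Finset.sum_apply, Pi.smul_apply, smul_eq_mul, Pi.zero_apply]
    rw [← dual_apply_rho_sum ρ ℓ s v hv g, hsum, map_zero, map_zero]
  exact linearIndependent_iff'.mp (linearIndependent_monoidHom G ℂ) s _ hfun χ hχ

/-- Two distinct characters have trivial common eigenspace. -/
theorem isotypic_inf_eq_bot (ρ : Representation ℂ G V) {χ₁ χ₂ : G →* ℂ} (h : χ₁ ≠ χ₂) :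
    isotypic ρ χ₁ ⊓ isotypic ρ χ₂ = ⊥ := by
  classical
  rw [eq_bot_iff]
  intro v hv
  rw [Submodule.mem_inf] at hv
  rw [Submodule.mem_bot]
  -- `v - v = 0` with `v ∈ V[χ₁]`, `-v ∈ V[χ₂]`
  have := eq_zero_of_sum_eq_zero ρ {χ₁, χ₂} (fun χ => if χ = χ₁ then v else -v)
    (by
      intro χ hχ
      simp only [Finset.mem_insert, Finset.mem_singleton] at hχ
      rcases hχ with rfl | rfl
      · simp [hv.1]
      · rw [if_neg (Ne.symm h)]
        exact (isotypic ρ χ).neg_mem hv.2)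
    (by
      rw [Finset.sum_insert (by simpa using h), Finset.sum_singleton, if_pos rfl,
        if_neg (Ne.symm h), add_neg_cancel])
  have h1 := this χ₁ (by simp)
  simpa using h1

/-- THE INDEPENDENCE HALF OF (A1), in general: the isotypic subspaces of the distinct characters of
an arbitrary group `G`, for an arbitrary complex representation, form an independent family. -/
theorem iSupIndep_isotypic (ρ : Representation ℂ G V) :
    iSupIndep fun χ : G →* ℂ => isotypic ρ χ := by
  classical
  refine iSupIndep_of_dfinsupp_lsum_injective _ ?_
  rw [injective_iff_map_eq_zero]
  intro f hf
  rw [DFinsupp.lsum_apply_apply, DFinsupp.sumAddHom_apply] at hf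
  -- `hf : f.sum (fun χ x => (x : V)) = 0`, i.e. `∑ χ ∈ f.support, (f χ : V) = 0`
  have hsum : ∑ χ ∈ f.support, ((f χ : isotypic ρ χ) : V) = 0 := hf
  have hzero := eq_zero_of_sum_eq_zero ρ f.support (fun χ => ((f χ : isotypic ρ χ) : V))
    (fun χ _ => (f χ).2) hsum
  ext χ
  by_cases hχ : χ ∈ f.support
  · have := hzero χ hχ
    simpa using this
  · rw [DFinsupp.notMem_support_iff] at hχ
    simp [hχ]

end Summit.Ventures.HodgeRepro2.T5IsotypicIndependence
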